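import Summits.Ventures.LatticeQCDFlow.Scaling.SimulatedTemperingFiniteSampler

/-!
HONEST FRAMING: exact (Metropolis-corrected) sampling algorithms for lattice gauge theory; figures
of merit are autocorrelation/cost numbers at stated couplings and volumes; no continuum-physics
claim.

# SimulatedTemperingModeBlocks — THE FINITE SIMULATED-TEMPERING SAMPLER DECOMPOSED WITH THE
# (LEVEL, MODE) PAIRS AS BLOCKS: restriction chains = the within-level updates RESTRICTED TO ONE MODE,
# projection chain = the "spider" (one overlap ladder per mode, the modes joined inside each level by the
# within-level updates' mode-to-mode flow) (lean-2 GEN-17, ours)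

Venture-side (OURS).  Cell `lqcd-flow` (pub-lqcd), unit `pub-lqcd-lean-2-g17`, 2026-08-25.  Chapter X
(`Scaling/SimulatedTemperingFinite*`, GEN-16) decomposed the random-scan simulated-tempering sampler
`P = stFinSampler t μ M` on `Fin (K+1) × S` with the LEVELS as blocks; the resulting ceiling
`τ_int ≤ 8(K+1)²/(a·min{1,γ_M}) − ½` carries the GLOBAL Poincaré constant `γ_M` of the within-level updates —
exponentially small exactly in the metastable situations (separated modes; for lattice gauge theory: topological
sectors at fine lattice spacing) that tempering is meant to cure.  This chapter (`SimulatedTemperingMode*`) uses the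
finer partition by LEVEL AND MODE: a partition of the configuration space presented by a map `mode : S → J`
(`J` finite; block `A_j = {x : mode x = j}`), block map `blk = Prod.map id mode : (k, x) ↦ (k, mode x)`.  Then
(Jerrum–Son–Tetali–Vigoda, PROVED in `Literature/Probability/MarkovChains/MarkovChainDecomposition`) the
sampler's spectral gap is controlled by (i) the Poincaré constants of the within-level updates RESTRICTED TO EACH
MODE (fast even under metastability), and (ii) the Poincaré constant of the projection chain on
`Fin (K+1) × J`, whose only edges are the overlap ladder INSIDE each mode and the mode-to-mode flow of `M_k`
INSIDE each level — for which the hottest level alone can suffice (`Scaling/SpiderPoincare`,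
`Scaling/SimulatedTemperingModeGap`).

## What is proved here (the block structure; finite-chain vocabulary of `Literature.Probability.MarkovChains`)

* §1 `modeBlk_apply`, `sum_block_modeBlk` — sums over the block `(k, j)` are sums over `A_j` at level `k`;
  **`stFinMode_blockMass`** — `π̄(k, j) = μ_k(A_j)/(K+1)` (`blockMass (μ k) mode j / (K+1)`);
  `sum_stFinMode_blockLaw_mul`, **`stFinMode_lawVariance_blockLaw`** — the block law of `(k, j)` is `μ_k`
  conditioned on `A_j` (`blockLaw (μ k) mode j`) carried on level `k`.
* §2 **`stFinMode_dirichletForm_restriction`** — the restriction chain of block `(k, j)` is the within-level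
  update restricted to the mode, slowed by `1 − t`:
  `𝓔_{π_(k,j)}(P_(k,j); f) = (1 − t)·𝓔_{μ_k|A_j}((M_k)_{A_j}; f(k,·))` EXACTLY (rejected level moves and rejected
  mode exits are diagonal); **`stFinMode_restriction_poincare`** — a uniform Poincaré constant `γ_A` of the
  mode-restricted within-level updates gives `(1 − t)γ_A` for every restriction chain.
* §3 **`stFinMode_blockFlow_vert`** — the flow `(i, j) → (l, j)` between two levels inside one mode is
  `[|i − l| = 1]·t·Σ_{x ∈ A_j} min{μ_i(x), μ_l(x)}/(2(K+1))` (the mode-restricted overlap);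
  **`stFinMode_blockFlow_horiz`** — the flow `(k, j) → (k, j′)` between two modes inside one level is
  `((1 − t)/(K+1))·Σ_{x ∈ A_j, y ∈ A_j′} μ_k(x)M_k(x,y)` (`blockFlow (μ k) (M k) mode j j′`): the projection chain
  is a "spider" — `|J|` overlap ladders glued level by level by the within-level updates' inter-mode flow;
  `stFinMode_escapeProb_le_one`, `modeBlk_surjective`.

NOT CLAIMED here: any Poincaré constant for the projection chain (next files); flows between different levels
AND different modes (they vanish — the level move keeps the configuration — but no lower bound needs them);
general configuration spaces; replica exchange; anything measured.  Literature grade (cell rule): KNOWN MECHANISM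
(state-space decomposition for tempering on multimodal targets: Madras–Zheng 2003, Woodard–Schmidler–Huber,
Ann. Appl. Probab. 19 (2009) 617–640), NEW TYPING (the exact block structure of the exact-weight finite sampler
for an arbitrary mode partition); nothing cited as a fact; no new bib keys.
-/

noncomputable section

open Finset
open Literature.Probability.MarkovChains
open Literature.Probability.MarkovChains.Decomposition

namespace Summit.Ventures.LatticeQCDFlow.Scaling

variable {S J : Type*} [Fintype S] [DecidableEq S] [DecidableEq J] {K : ℕ}
  {μ : Fin (K + 1) → S → ℝ} {M : Fin (K + 1) → Matrix S S ℝ} {t : ℝ} {mode : S → J}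

/-! ## §1 The blocks `(level, mode)`: sums, masses, block laws -/

omit [Fintype S] [DecidableEq S] [DecidableEq J] in
/-- The block map `blk = Prod.map id mode` sends `(k, x)` to `(k, mode x)`. [ours] -/
theorem modeBlk_apply (mode : S → J) (p : Fin (K + 1) × S) : Prod.map id mode p = (p.1, mode p.2) := rfl

omit [Fintype S] [DecidableEq S] [DecidableEq J] in
/-- Every block `(k, j)` is nonempty as soon as every mode is. [ours] -/
theorem modeBlk_surjective (hmode : Function.Surjective mode) :
    Function.Surjective (Prod.map id mode : Fin (K + 1) × S → Fin (K + 1) × J) :=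
  Function.surjective_id.prodMap hmode

omit [DecidableEq S] in
/-- Summing over the block `(k, j)` is summing over the configurations of mode `j` at level `k`. [ours] -/
theorem sum_block_modeBlk (k : Fin (K + 1)) (j : J) (g : Fin (K + 1) × S → ℝ) :
    ∑ p ∈ block (Prod.map id mode) (k, j), g p = ∑ x ∈ block mode j, g (k, x) := by
  unfold block
  rw [Finset.sum_filter, Finset.sum_filter, Fintype.sum_prod_type, Finset.sum_comm]
  refine sum_congr rfl fun y _ => ?_
  have h : ∀ l : Fin (K + 1), (Prod.map id mode (l, y) = (k, j)) ↔ (l = k ∧ mode y = j) := fun l => by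
    rw [modeBlk_apply, Prod.mk.injEq]
  simp_rw [if_congr (h _) rfl rfl, ite_and]
  rw [Finset.sum_ite_eq' univ k, if_pos (mem_univ _)]

omit [DecidableEq S] in
/-- **Every block `(k, j)` carries mass `μ_k(A_j)/(K+1)`** (exact weights). [ours] -/
theorem stFinMode_blockMass (k : Fin (K + 1)) (j : J) :
    blockMass (stFinLaw μ) (Prod.map id mode) (k, j) = blockMass (μ k) mode j / (K + 1) := by
  unfold blockMass
  rw [sum_block_modeBlk, Finset.sum_div]
  rfl

omit [DecidableEq S] in
/-- Integrals against the block law of `(k, j)` are integrals against `μ_k` conditioned on `A_j` of the level-`k`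
slice. [ours] -/
theorem sum_stFinMode_blockLaw_mul (k : Fin (K + 1)) (j : J) (g : Fin (K + 1) × S → ℝ) :
    ∑ p, blockLaw (stFinLaw μ) (Prod.map id mode) (k, j) p * g p = ∑ y, blockLaw (μ k) mode j y * g (k, y) := by
  rw [sum_blockLaw_mul, sum_blockLaw_mul, stFinMode_blockMass, sum_block_modeBlk]
  have h : ∑ x ∈ block mode j, stFinLaw μ (k, x) * g (k, x) = (∑ x ∈ block mode j, μ k x * g (k, x)) / (K + 1) := by
    rw [Finset.sum_div]
    refine sum_congr rfl fun x _ => ?_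
    unfold stFinLaw
    ring
  rw [h]
  exact div_div_div_cancel_right₀ (by positivity) _ _

omit [DecidableEq S] in
/-- **The block variance of `(k, j)` is the variance of the slice under `μ_k` conditioned on `A_j`.** [ours] -/
theorem stFinMode_lawVariance_blockLaw (k : Fin (K + 1)) (j : J) (f : Fin (K + 1) × S → ℝ) :
    lawVariance (blockLaw (stFinLaw μ) (Prod.map id mode) (k, j)) f
      = lawVariance (blockLaw (μ k) mode j) (fun y => f (k, y)) := by
  unfold lawVariance lawMean
  rw [sum_stFinMode_blockLaw_mul k j f]
  exact sum_stFinMode_blockLaw_mul k j _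

/-! ## §2 The restriction chains: the within-level update restricted to one mode -/

/-- **The restriction chain of block `(k, j)` is the within-level update restricted to the mode, slowed by
`1 − t`:** `𝓔_{π_(k,j)}(P_(k,j); f) = (1 − t)·𝓔_{μ_k|A_j}((M_k)_{A_j}; f(k,·))` — rejected level moves and rejected
mode exits are diagonal, the level move never changes the configuration. [ours] -/
theorem stFinMode_dirichletForm_restriction (k : Fin (K + 1)) (j : J) (f : Fin (K + 1) × S → ℝ) :
    dirichletForm (blockLaw (stFinLaw μ) (Prod.map id mode) (k, j))
        (restrictionChain (stFinSampler t μ M) (Prod.map id mode)) f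
      = (1 - t) * dirichletForm (blockLaw (μ k) mode j) (restrictionChain (M k) mode) (fun y => f (k, y)) := by
  have inner : ∀ x : S,
      ∑ q, restrictionChain (stFinSampler t μ M) (Prod.map id mode) (k, x) q * (f (k, x) - f q) ^ 2
        = (1 - t) * ∑ y, restrictionChain (M k) mode x y * (f (k, x) - f (k, y)) ^ 2 := by
    intro x
    have hR : ∑ y, restrictionChain (M k) mode x y * (f (k, x) - f (k, y)) ^ 2
        = ∑ y ∈ block mode (mode x), M k x y * (f (k, x) - f (k, y)) ^ 2 :=
      sum_restrictionChain_mul_sq_sub (M k) mode (fun y => f (k, y)) x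
    rw [sum_restrictionChain_mul_sq_sub, hR,
      show block (Prod.map id mode) (Prod.map id mode (k, x)) = block (Prod.map id mode) (k, mode x) from rfl,
      sum_block_modeBlk k (mode x) (fun q => stFinSampler t μ M (k, x) q * (f (k, x) - f q) ^ 2),
      Finset.mul_sum]
    refine sum_congr rfl fun y _ => ?_
    rw [stFinSampler_apply, add_mul, mul_assoc, stFinLevel_sameLevel_mul_sq, mul_zero, zero_add,
      stFinWithin_apply, if_pos rfl, mul_assoc]
  have key : ∑ p, ∑ q, blockLaw (stFinLaw μ) (Prod.map id mode) (k, j) p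
        * restrictionChain (stFinSampler t μ M) (Prod.map id mode) p q * (f p - f q) ^ 2
      = (1 - t) * ∑ x, ∑ y, blockLaw (μ k) mode j x * restrictionChain (M k) mode x y
          * (f (k, x) - f (k, y)) ^ 2 := by
    simp_rw [mul_assoc, ← Finset.mul_sum]
    rw [sum_stFinMode_blockLaw_mul k j]
    simp_rw [inner]
    rw [Finset.mul_sum]
    refine sum_congr rfl fun x _ => ?_
    rw [mul_left_comm, Finset.mul_sum, Finset.mul_sum]
  unfold dirichletForm
  rw [key]
  ring

/-- **Poincaré inequality for the restriction chains:** a uniform Poincaré constant `γ_A` of the within-level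
updates RESTRICTED TO EACH MODE (`γ_A·Var_{μ_k|A_j}(h) ≤ 𝓔_{μ_k|A_j}((M_k)_{A_j}; h)` for all `k`, `j`, `h`) gives
`(1 − t)γ_A·Var ≤ 𝓔` for every restriction chain of the sampler (`t ≤ 1`).  No MODE-TO-MODE mixing of any
`M_k` is asked. [ours] -/
theorem stFinMode_restriction_poincare (ht1 : t ≤ 1) {γ : ℝ}
    (hgap : ∀ k j, ∀ h : S → ℝ, γ * lawVariance (blockLaw (μ k) mode j) h
      ≤ dirichletForm (blockLaw (μ k) mode j) (restrictionChain (M k) mode) h)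
    (b : Fin (K + 1) × J) (f : Fin (K + 1) × S → ℝ) :
    (1 - t) * γ * lawVariance (blockLaw (stFinLaw μ) (Prod.map id mode) b) f
      ≤ dirichletForm (blockLaw (stFinLaw μ) (Prod.map id mode) b)
          (restrictionChain (stFinSampler t μ M) (Prod.map id mode)) f := by
  obtain ⟨k, j⟩ := b
  rw [stFinMode_lawVariance_blockLaw, stFinMode_dirichletForm_restriction, mul_assoc]
  exact mul_le_mul_of_nonneg_left (hgap k j _) (by linarith)

/-! ## §3 The projection chain: a spider of overlap ladders -/

/-- **The flow between two levels inside one mode is the mode-restricted overlap:**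
`blockFlow (i, j) (l, j) = [|i − l| = 1]·t·Σ_{x ∈ A_j} min{μ_i(x), μ_l(x)}/(2(K+1))` (`i ≠ l`) — the within-level
updates are invisible to it. [ours] -/
theorem stFinMode_blockFlow_vert (hμ : ∀ k x, 0 < μ k x) {i l : Fin (K + 1)} (hil : i ≠ l) (j : J) :
    blockFlow (stFinLaw μ) (stFinSampler t μ M) (Prod.map id mode) (i, j) (l, j)
      = if (l.val = i.val + 1 ∨ i.val = l.val + 1)
          then t * (∑ x ∈ block mode j, min (μ i x) (μ l x)) / (2 * (K + 1)) else 0 := by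
  unfold blockFlow
  rw [sum_block_modeBlk]
  simp_rw [sum_block_modeBlk]
  have h : ∀ x y : S, stFinLaw μ (i, x) * stFinSampler t μ M (i, x) (l, y)
      = t * (if y = x ∧ (l.val = i.val + 1 ∨ i.val = l.val + 1)
          then min (μ i x) (μ l x) / (2 * (K + 1)) else 0) := by
    intro x y
    have hq : ((l, y) : Fin (K + 1) × S) ≠ (i, x) := fun e => hil (Prod.mk.inj e).1.symm
    have hne : ((l, y) : Fin (K + 1) × S).1 ≠ ((i, x) : Fin (K + 1) × S).1 := Ne.symm hil
    rw [stFinSampler_apply, stFinWithin_apply, if_neg hne, mul_zero, add_zero, mul_left_comm,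
      stFinLaw_mul_stFinLevel hμ hq]
  simp_rw [h, ← Finset.mul_sum, ite_and]
  rw [Finset.sum_congr rfl fun x hx => by rw [Finset.sum_ite_eq' (block mode j) x, if_pos hx]]
  split_ifs with hadj
  · rw [← Finset.sum_div]
    ring
  · simp

/-- **The flow between two modes inside one level is the within-level update's inter-mode flow, slowed by
`1 − t` and weighted by the level mass:** `blockFlow (k, j) (k, j′) = ((1 − t)/(K+1))·Σ_{x ∈ A_j, y ∈ A_j′}
μ_k(x)M_k(x,y)` (`j ≠ j′`) — the level move never changes the configuration, hence never the mode. [ours] -/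
theorem stFinMode_blockFlow_horiz (k : Fin (K + 1)) {j j' : J} (hjj : j ≠ j') :
    blockFlow (stFinLaw μ) (stFinSampler t μ M) (Prod.map id mode) (k, j) (k, j')
      = (1 - t) / (K + 1) * blockFlow (μ k) (M k) mode j j' := by
  unfold blockFlow
  rw [sum_block_modeBlk, Finset.mul_sum]
  simp_rw [sum_block_modeBlk]
  refine sum_congr rfl fun x hx => ?_
  rw [Finset.mul_sum]
  refine sum_congr rfl fun y hy => ?_
  have hne : ((k, y) : Fin (K + 1) × S).2 ≠ ((k, x) : Fin (K + 1) × S).2 := by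
    intro e
    rw [mem_block] at hx hy
    exact hjj (hx.symm.trans ((congrArg mode e).symm.trans hy))
  rw [stFinSampler_apply, stFinLevel_eq_zero_of_ne hne, mul_zero, zero_add, stFinWithin_apply, if_pos rfl]
  unfold stFinLaw
  ring

/-- The one-step escape probability from a block is at most `1` (a probability). [ours] -/
theorem stFinMode_escapeProb_le_one (hμ : ∀ k x, 0 < μ k x) (hM : ∀ k, IsRowStochastic (M k))
    (ht0 : 0 ≤ t) (ht1 : t ≤ 1) (p : Fin (K + 1) × S) :
    escapeProb (stFinSampler t μ M) (Prod.map id mode) p ≤ 1 :=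
  (escapeProb_le_escapeParameter _ _ p).trans
    (escapeParameter_le_one (stFinSampler_isRowStochastic hμ hM ht0 ht1) _)

end Summit.Ventures.LatticeQCDFlow.Scaling

end
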